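import Mathlib
import HarnessLib
import Summits.ValiantsHypothesis.ValiantsHypothesis.Theorems.MonotoneRestorationMonotoneRestorationQPLinearWidthAffineWitnessGrid
import Summits.ValiantsHypothesis.ValiantsHypothesis.Theorems.MonotoneRestorationMonotoneRestorationQPLinearWidthMinorTrans

/-!
# Route MonotoneRestoration, crux `MonotoneRestorationQP` (stmt-15886), line `linear_width` —
# THE EXCLUDED GRID THEOREM IN THE LINE'S FORMAT: Chuzhoy–Tan's printed statement ⇒ (GM)_{gm} with a polynomial `gm`

Helper file (`--supports stmt-ValiantsHypothesis-15886`), def-free.  Item (GM) of the g14/g15 residue lists.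

The `√N`-rung capstones of the line (`AffineWitness.widthRung_sqrt_of_gridMinor_of_reembedding`, p841791;
`CFIOddCover.widthRung_sqrt_of_chains`, this session) consume the Excluded Grid Theorem as a FUNCTION form
**(GM)_{gm}**: `gm r ≤ tw F ⇒ grid r r ≼ₘ F` for every finite graph `F`, with `gm r ≤ (r+2)^e`.  The tree's currency for the
theorem in print is Chuzhoy–Tan's statement (CT) "there are `c₁, c₂ > 0` such that for every `g ≥ 2` every graph of
tree-width `≥ c₁ g⁹ log^{c₂} g` contains the `g × g` grid as a minor", used as an explicit hypothesis in
`Literature/Computability/MetaComplexity/TseitinDepthFregeExcludedGrid.lean` (`excludedGridForm_of_chuzhoyTanForm`).  Here: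

* `grid_isMinor_grid_succ` — `grid r r ≼ₘ grid (r+1) (r+1)` (the corner subgrid; via `isMinor_of_injective_hom`, p841952);
* **`gridMinorForm_of_chuzhoyTanForm`** — (CT) ⇒ (GM)_{gm} with `gm r = ⌈c₁ (r+2)⁹ log^{c₂}(r+2)⌉` and the polynomial bound
  `gm r ≤ (r+2)^(⌈c₁⌉ + 9 + ⌈c₂⌉)` (`log x ≤ x`, `c₁ ≤ 2^{⌈c₁⌉} ≤ (r+2)^{⌈c₁⌉}`); the `g × g` grid of (CT) with `g = r+2` is
  the tree's `grid (r+1) (r+1)`, which contains `grid r r`;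
* **`widthRung_sqrt_of_chuzhoyTan_of_reembedding`** — the `√N` rung from (CT) and g14's re-embedding lemma (RE)_c, i.e.
  p841791 with its (GM) hypothesis discharged from the printed theorem.

Honest label: (CT) is Chuzhoy–Tan 2021 Thm 1.1 (in print, not proved in the tree; carried as a hypothesis exactly as in the
Tseitin files); (RE) / the chain-system supply remain owed.  No stub closed; θ₁, the cruxes and VP ≠ VNP NOT moved.
[cite: ChuzhoyTan2021, Theorem 1.1; GalesiEtAl2023, Theorem 8 and Corollary 9; Diestel2010, §1.7]
-/

set_option linter.dupNamespace false

noncomputable section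

open scoped Classical
open scoped Literature.Combinatorics.SimpleGraph

namespace Summit.ValiantsHypothesis.ValiantsHypothesis.Theorems.CFIOddCover

open Literature.Combinatorics.SimpleGraph (treewidth IsMinor IsTopologicalMinor wall grid grid_adj)
open Literature.ModelTheory.FiniteModelTheory Literature.ModelTheory.FiniteModelTheory.ChenFlumLiu2025
open Summit.ValiantsHypothesis.ValiantsHypothesis.Theorems.MonotoneRestorationQPLinearWidth

/-! ### The corner subgrid -/

/-- **`grid r r ≼ₘ grid (r+1) (r+1)`**: the `(r+1) × (r+1)` grid sits in the corner of the `(r+2) × (r+2)` grid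
(coordinatewise `Fin.castSucc`, an injective homomorphism). [cite: Diestel2010, §1.7; GalesiEtAl2023, §2 (grids)] -/
theorem grid_isMinor_grid_succ (r : ℕ) : grid r r ≼ₘ grid (r + 1) (r + 1) := by
  refine isMinor_of_injective_hom
    ⟨fun p => (Fin.castSucc p.1, Fin.castSucc p.2), fun {p q} h => ?_⟩ fun p q hpq => ?_
  · rw [grid_adj] at h ⊢
    simpa [Fin.ext_iff] using h
  · have h : (Fin.castSucc p.1, Fin.castSucc p.2) = (Fin.castSucc q.1, Fin.castSucc q.2) := hpq
    simp only [Prod.mk.injEq, Fin.castSucc_inj] at h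
    exact Prod.ext h.1 h.2

/-! ### Chuzhoy–Tan ⇒ the function form with a polynomial bound -/

/-- `log x ≤ x` for `x ≥ 1`, in `rpow` form: `(log x)^c ≤ x^c` for `c ≥ 0`. [folklore] -/
theorem log_rpow_le_rpow {x c : ℝ} (hx : 1 ≤ x) (hc : 0 ≤ c) : Real.log x ^ c ≤ x ^ c :=
  Real.rpow_le_rpow (Real.log_nonneg hx) ((Real.log_le_sub_one_of_pos (by linarith)).trans (by linarith)) hc

/-- The Chuzhoy–Tan threshold is polynomially bounded: `c₁ (r+2)⁹ log^{c₂}(r+2) ≤ (r+2)^(⌈c₁⌉ + 9 + ⌈c₂⌉)`.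
[cite: ChuzhoyTan2021, Theorem 1.1] -/
theorem chuzhoyTan_threshold_le_pow {c₁ c₂ : ℝ} (hc₂ : 0 < c₂) (r : ℕ) :
    c₁ * ((r : ℝ) + 2) ^ 9 * Real.log ((r : ℝ) + 2) ^ c₂ ≤ ((r : ℝ) + 2) ^ (⌈c₁⌉₊ + 9 + ⌈c₂⌉₊) := by
  have hx : (1 : ℝ) ≤ (r : ℝ) + 2 := by have := (Nat.cast_nonneg r : (0 : ℝ) ≤ r); linarith
  have hx2 : (2 : ℝ) ≤ (r : ℝ) + 2 := by have := (Nat.cast_nonneg r : (0 : ℝ) ≤ r); linarith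
  have hx0 : (0 : ℝ) < (r : ℝ) + 2 := by linarith
  -- `c₁ ≤ (r+2)^⌈c₁⌉`
  have h1 : c₁ ≤ ((r : ℝ) + 2) ^ ⌈c₁⌉₊ := by
    calc c₁ ≤ (⌈c₁⌉₊ : ℝ) := Nat.le_ceil c₁
      _ ≤ (2 : ℝ) ^ ⌈c₁⌉₊ := by
          have : (⌈c₁⌉₊ : ℝ) < (2 : ℝ) ^ ⌈c₁⌉₊ := by exact_mod_cast Nat.lt_two_pow_self
          exact this.le
      _ ≤ ((r : ℝ) + 2) ^ ⌈c₁⌉₊ := pow_le_pow_left₀ (by norm_num) hx2 _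
  -- `log^{c₂} ≤ (r+2)^{c₂} ≤ (r+2)^⌈c₂⌉`
  have h2 : Real.log ((r : ℝ) + 2) ^ c₂ ≤ ((r : ℝ) + 2) ^ ⌈c₂⌉₊ := by
    calc Real.log ((r : ℝ) + 2) ^ c₂ ≤ ((r : ℝ) + 2) ^ c₂ := log_rpow_le_rpow hx hc₂.le
      _ ≤ ((r : ℝ) + 2) ^ ((⌈c₂⌉₊ : ℕ) : ℝ) := Real.rpow_le_rpow_of_exponent_le hx (Nat.le_ceil c₂)
      _ = ((r : ℝ) + 2) ^ ⌈c₂⌉₊ := Real.rpow_natCast _ _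
  have hlog0 : 0 ≤ Real.log ((r : ℝ) + 2) ^ c₂ := Real.rpow_nonneg (Real.log_nonneg hx) _
  calc c₁ * ((r : ℝ) + 2) ^ 9 * Real.log ((r : ℝ) + 2) ^ c₂
      ≤ ((r : ℝ) + 2) ^ ⌈c₁⌉₊ * ((r : ℝ) + 2) ^ 9 * ((r : ℝ) + 2) ^ ⌈c₂⌉₊ := by
        gcongr
    _ = ((r : ℝ) + 2) ^ (⌈c₁⌉₊ + 9 + ⌈c₂⌉₊) := by rw [pow_add, pow_add]

/-- **(CT) ⇒ (GM)_{gm} WITH A POLYNOMIAL `gm`.**  Chuzhoy–Tan's Excluded Grid Theorem as printed — "there exist constants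
`c₁, c₂ > 0` such that for every integer `g ≥ 2`, every graph of treewidth at least `c₁ g⁹ log^{c₂} g` contains the
`(g × g)`-grid as a minor" (the `g × g` grid being the tree's `grid (g-1) (g-1)`) — yields a threshold function `gm` with
`gm r ≤ (r+2)^e` such that every finite graph of tree-width `≥ gm r` has the tree's `grid r r` as a minor (apply (CT) with
`g = r + 2` and pass to the corner subgrid). [cite: ChuzhoyTan2021, Theorem 1.1; GalesiEtAl2023, Theorem 8] -/
theorem gridMinorForm_of_chuzhoyTanForm
    (hCT : ∃ c₁ : ℝ, 0 < c₁ ∧ ∃ c₂ : ℝ, 0 < c₂ ∧ ∀ g : ℕ, 2 ≤ g →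
      ∀ (V : Type) [Fintype V] (G : SimpleGraph V),
        c₁ * (g : ℝ) ^ 9 * Real.log g ^ c₂ ≤ treewidth G → grid (g - 1) (g - 1) ≼ₘ G) :
    ∃ (gm : ℕ → ℕ) (e : ℕ), (∀ r, gm r ≤ (r + 2) ^ e) ∧
      ∀ (r : ℕ) {V : Type} [Fintype V] (F : SimpleGraph V), gm r ≤ treewidth F → grid r r ≼ₘ F := by
  obtain ⟨c₁, hc₁, c₂, hc₂, hCT⟩ := hCT
  refine ⟨fun r => ⌈c₁ * ((r : ℝ) + 2) ^ 9 * Real.log ((r : ℝ) + 2) ^ c₂⌉₊, ⌈c₁⌉₊ + 9 + ⌈c₂⌉₊,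
    fun r => ?_, fun r V _ F hF => ?_⟩
  · -- the polynomial bound
    have h := chuzhoyTan_threshold_le_pow (c₁ := c₁) hc₂ r
    have hcast : ((r : ℝ) + 2) ^ (⌈c₁⌉₊ + 9 + ⌈c₂⌉₊) = (((r + 2) ^ (⌈c₁⌉₊ + 9 + ⌈c₂⌉₊) : ℕ) : ℝ) := by
      push_cast; ring
    rw [hcast] at h
    exact Nat.ceil_le.2 h
  · -- apply (CT) with `g = r + 2`
    have hg : c₁ * ((r + 2 : ℕ) : ℝ) ^ 9 * Real.log ((r + 2 : ℕ) : ℝ) ^ c₂ ≤ treewidth F := by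
      have h1 := Nat.le_ceil (c₁ * ((r : ℝ) + 2) ^ 9 * Real.log ((r : ℝ) + 2) ^ c₂)
      have h2 : ((⌈c₁ * ((r : ℝ) + 2) ^ 9 * Real.log ((r : ℝ) + 2) ^ c₂⌉₊ : ℕ) : ℝ) ≤ (treewidth F : ℝ) := by
        exact_mod_cast hF
      push_cast
      linarith
    have hmin : grid (r + 2 - 1) (r + 2 - 1) ≼ₘ F := hCT (r + 2) (by omega) V F hg
    have heq : r + 2 - 1 = r + 1 := by omega
    rw [heq] at hmin
    exact IsMinor.trans (grid_isMinor_grid_succ r) hmin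

/-! ### The `√N` rung from the printed theorem and the re-embedding lemma -/

/-- **THE `√N` RUNG FROM CHUZHOY–TAN AND (RE).**  Chuzhoy–Tan's Excluded Grid Theorem (as printed, hypothesis (CT)) and the
re-embedding lemma (RE)_c of census g14 imply `WidthRung (fun n => Nat.sqrt n / 45)` — p841791 with its hypothesis (GM)
discharged from (CT). [cite: ChuzhoyTan2021, Theorem 1.1; DawarPagoSeppelt2025, Thm 7.3, Thm 7.9] -/
theorem widthRung_sqrt_of_chuzhoyTan_of_reembedding
    (hCT : ∃ c₁ : ℝ, 0 < c₁ ∧ ∃ c₂ : ℝ, 0 < c₂ ∧ ∀ g : ℕ, 2 ≤ g →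
      ∀ (V : Type) [Fintype V] (G : SimpleGraph V),
        c₁ * (g : ℝ) ^ 9 * Real.log g ^ c₂ ≤ treewidth G → grid (g - 1) (g - 1) ≼ₘ G)
    (c : ℕ) (hc : 1 ≤ c)
    (hRE : ∀ (r : ℕ) {V : Type} [Fintype V] (F : SimpleGraph V), 1 ≤ r → wall (c * r) ≼ₜ F →
      ∃ (v : ℕ) (B : SimpleGraph (Fin v)), B.Connected ∧ 2 ≤ v ∧
        r ≤ treewidth B ∧ B.edgeSet.Nonempty ∧
        v ≤ Fintype.card V ∧ Fintype.card (CFIVertex B) ≤ 14 * v ∧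
        ∃ σ : subdiv B →g F, Function.Injective σ) :
    WidthRung fun n => Nat.sqrt n / 45 := by
  obtain ⟨gm, e, hgm, hGM⟩ := gridMinorForm_of_chuzhoyTanForm hCT
  exact AffineWitness.widthRung_sqrt_of_gridMinor_of_reembedding gm e c hc hgm
    (fun r V _ F h => hGM r F h) hRE

end Summit.ValiantsHypothesis.ValiantsHypothesis.Theorems.CFIOddCover

end
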